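import Mathlib.MeasureTheory.Measure.Haar.Quotient
import Mathlib.MeasureTheory.Group.ModularCharacter
import Mathlib.Topology.Algebra.ProperAction.Basic
import Mathlib.Topology.Metrizable.Urysohn
import Literature.MeasureTheory.Group.DiscreteFundamentalDomain
import Literature.MeasureTheory.Group.InvariantQuotientUnfolding
import Literature.NumberTheory.Automorphic.AdelicGroupData
import HarnessLib

/-!
# Automorphic measures on compact automorphic quotients

Sibling proof file (theorems only, no `sorry`, no named fact) of
`Literature.NumberTheory.Automorphic.AdelicGroupData`. It PROVES the existence of an automorphic
measure (`AdelicGroupData.IsAutomorphicMeasure`: finite, positive on non-empty open sets, inner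
regular, `G(𝔸_K)`-invariant) on the automorphic quotient `G(𝔸_K) ⧸ (A_G · G(K))` of an adelic
group datum `𝒢` whenever

* `G(𝔸_K)` is locally compact, second countable and Hausdorff, and `G(K)` is discrete in it;
* there is a continuous *central retraction* `θ : G(𝔸_K) →* A_G` (values in `A_G`, the identity
  on `A_G`, trivial on `G(K)`), as for `GL_n` (`exists_centralRetraction_gl`: `θ(g) =
  z(|det g|^{1/n[K:ℚ]})`) and for the unit groups of division algebras (`θ(g) = z(‖g‖^{1/N})`);
  then `G(𝔸_K) = G(𝔸_K)¹ × A_G` with `G(𝔸_K)¹ = ker θ ⊇ G(K)` and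
  `G(𝔸_K) ⧸ (A_G · G(K)) ≃ₜ G(𝔸_K)¹ ⧸ G(K)`;
* the modular function of `G(𝔸_K)¹` is trivial on `G(K)`;
* the automorphic quotient is compact

(`AdelicGroupData.exists_isAutomorphicMeasure_of_compactSpace`), and more generally whenever some
subset of `G(𝔸_K)¹` of finite Haar measure meets every coset of `A_G · G(K)`
(`AdelicGroupData.exists_isAutomorphicMeasure_of_cover` — the shape of Borel–Harish-Chandra's
theorem, with a Siegel set as the covering set; `exists_retraction_homeomorph` is the splitting
`G(𝔸_K) ⧸ (A_G · G(K)) ≃ₜ G(𝔸_K)¹ ⧸ G(K)`). This is the classical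
construction of the invariant measure on `G ⧸ Γ` for a discrete subgroup `Γ` of a locally compact
group `G` whose modular function is trivial on `Γ` (Raghunathan, *Discrete subgroups of Lie
groups* (1972), Ch. I, 1.4–1.9; Weil, *L'intégration dans les groupes topologiques* (1940), §9;
Borel, *Some finiteness properties of adele groups over number fields*, Publ. Math. IHÉS 16
(1963), §5, for the adelic setting `G_A / G_k A`): restrict a left Haar measure of `G` — which is
then also right-`Γ`-invariant — to a Borel fundamental domain of `Γ` and push it to `G ⧸ Γ`
(`exists_smulInvariantMeasure_quotient_of_cover`,
`exists_smulInvariantMeasure_quotient_of_compactSpace`, via Mathlib's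
`MeasureTheory.QuotientMeasureEqMeasurePreimage.smulInvariantMeasure_quotient` and the Borel
fundamental domains of `Literature.MeasureTheory.Group.DiscreteFundamentalDomain`); a covering
set of finite measure (e.g. a compact one when `G ⧸ Γ` is compact) makes it finite, and invariant
open sets of measure zero being Haar-null makes it positive on open sets.

Also proved: `modularCharacter_eq_one_of_mem_center` (the modular function is `1` on the centre)
and `modularCharacter_eq_one_of_mul_conj_eq` (an element `x` with `x · (j x j⁻¹)` central has
modular function `1`), the group-theoretic input used for unit groups of quaternion division
algebras in `QuaternionAlgebraAdelicMeasureProofs`.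

## References

* M. S. Raghunathan, *Discrete subgroups of Lie groups*, Ergebnisse 68 (1972), Ch. I, 1.4–1.9.
* A. Borel, *Some finiteness properties of adele groups over number fields*, Publ. Math. IHÉS 16
  (1963), §5 [Borel1963].
* G. B. Folland, *A Course in Abstract Harmonic Analysis* (1995), §2.6 (Thm. 2.49) [Folland1995].
-/

noncomputable section

open MeasureTheory Measure Set Filter Topology
open scoped ENNReal NNReal Pointwise

namespace Literature.NumberTheory.Automorphic

universe u

/-! ### The modular function on central elements and on "self-conjugate" elements -/

section ModularCharacter

variable {G : Type*} [Group G] [TopologicalSpace G] [IsTopologicalGroup G] [LocallyCompactSpace G]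
  [SecondCountableTopology G]

/-- **The modular function is trivial on the centre**: for `z ∈ Z(G)` right and left translation
by `z` agree, so `μ(E z) = μ(z E) = μ(E)` for a left Haar measure `μ`, i.e. `Δ(z) = 1`
(Mathlib `modularCharacter`, `map_right_mul_eq_modularCharacterFun_smul`). [folklore] -/
theorem modularCharacter_eq_one_of_mem_center {z : G} (hz : z ∈ Subgroup.center G) :
    modularCharacter z = 1 := by
  borelize G
  set ν : Measure G := haar with hν
  have h1 : map (· * z) ν = modularCharacterFun z • ν :=
    map_right_mul_eq_modularCharacterFun_smul ν z
  have h2 : (fun x : G => x * z) = fun x => z * x :=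
    funext fun x => (Subgroup.mem_center_iff.1 hz x)
  rw [h2, map_mul_left_eq_self] at h1
  obtain ⟨K⟩ := (inferInstance : Nonempty (TopologicalSpace.PositiveCompacts G))
  have hK0 : ν K ≠ 0 := (Measure.measure_pos_of_nonempty_interior ν K.interior_nonempty).ne'
  have hKtop : ν K ≠ ∞ := K.isCompact.measure_lt_top.ne
  have h3 : ν K = ((modularCharacterFun z : ℝ≥0) : ℝ≥0∞) * ν K := by
    have := congrArg (fun m : Measure G => m K) h1
    simpa only [Measure.smul_apply, ENNReal.smul_def, smul_eq_mul] using this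
  have h4 : ((modularCharacterFun z : ℝ≥0) : ℝ≥0∞) = 1 := by
    have h5 : (1 : ℝ≥0∞) * ν K = ((modularCharacterFun z : ℝ≥0) : ℝ≥0∞) * ν K := by
      rw [one_mul]; exact h3
    exact ((ENNReal.mul_left_inj hK0 hKtop).1 h5).symm
  change modularCharacterFun z = 1
  exact_mod_cast h4

/-- **An element `x` such that `x · (j x j⁻¹)` is central (for some `j`) has modular function `1`**:
`Δ` is a homomorphism to the commutative group `ℝ_{>0}`, so `Δ(j x j⁻¹) = Δ(x)` and
`Δ(x)² = Δ(x · j x j⁻¹) = 1` (`modularCharacter_eq_one_of_mem_center`). (Used for the rational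
units of a quaternion division algebra: `x x̄ = nrd(x)` is central and `x̄` is conjugate to `x`.)
[folklore] -/
theorem modularCharacter_eq_one_of_mul_conj_eq {x j z : G} (hz : z ∈ Subgroup.center G)
    (h : x * (j * x * j⁻¹) = z) : modularCharacter x = 1 := by
  have hj0 : modularCharacter j ≠ 0 := (modularCharacterFun_pos j).ne'
  have h1 : modularCharacter x * modularCharacter x = 1 := by
    have h2 := congrArg modularCharacter h
    rw [map_mul, map_mul, map_mul, map_inv, modularCharacter_eq_one_of_mem_center hz,
      mul_comm (modularCharacter j) (modularCharacter x), mul_inv_cancel_right₀ hj0] at h2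
    exact h2
  have h3 : ((modularCharacter x : ℝ≥0) : ℝ) ^ 2 = 1 := by
    rw [sq]; exact_mod_cast h1
  have h4 := (pow_eq_one_iff_of_nonneg (NNReal.coe_nonneg _) two_ne_zero).1 h3
  exact_mod_cast h4

end ModularCharacter

/-! ### Invariant probability measures on compact quotients `G ⧸ Γ`, `Γ` discrete -/

section Quotient

variable {G : Type*} [Group G] [TopologicalSpace G] [IsTopologicalGroup G]

/-- If `Γ ≤ G` is a subgroup of a weakly locally compact topological group with compact coset
space `G ⧸ Γ`, some compact `B ⊆ G` maps onto `G ⧸ Γ` (the quotient map is open; multiplicative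
twin of `exists_isCompact_image_mk_eq_univ` of `QuaternionAlgebraAdelicProofs`). [folklore] -/
theorem exists_isCompact_image_coe_eq_univ [WeaklyLocallyCompactSpace G] (Γ : Subgroup G)
    [CompactSpace (G ⧸ Γ)] :
    ∃ B : Set G, IsCompact B ∧ (QuotientGroup.mk : G → G ⧸ Γ) '' B = Set.univ := by
  choose k hk hk' using fun x : G => exists_compact_mem_nhds x
  have hcov : (Set.univ : Set (G ⧸ Γ)) ⊆
      ⋃ x : G, (QuotientGroup.mk : G → G ⧸ Γ) '' interior (k x) := by
    rintro q -
    obtain ⟨x, rfl⟩ := QuotientGroup.mk_surjective q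
    exact Set.mem_iUnion.2 ⟨x, x, mem_interior_iff_mem_nhds.2 (hk' x), rfl⟩
  obtain ⟨t, ht⟩ := isCompact_univ.elim_finite_subcover _
    (fun x => QuotientGroup.isOpenMap_coe _ isOpen_interior) hcov
  refine ⟨⋃ x ∈ t, k x, t.isCompact_biUnion fun x _ => hk x, Set.eq_univ_of_forall fun q => ?_⟩
  obtain ⟨x, hx, hq⟩ : ∃ x ∈ t, q ∈ (QuotientGroup.mk : G → G ⧸ Γ) '' interior (k x) := by
    simpa only [Set.mem_iUnion, exists_prop] using ht (Set.mem_univ q)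
  obtain ⟨y, hy, rfl⟩ := hq
  exact ⟨y, Set.mem_biUnion hx (interior_subset hy), rfl⟩

variable [LocallyCompactSpace G] [SecondCountableTopology G] [T2Space G]
  [MeasurableSpace G] [BorelSpace G]

/-- On the coset space of a closed subgroup of a locally compact second countable Hausdorff group,
Mathlib's quotient σ-algebra (`QuotientGroup.measurableSpace`) is the Borel σ-algebra
(`Literature.MeasureTheory.Group.map_mk_borel_eq_borel`). [folklore] -/
theorem borelSpace_quotient (Γ : Subgroup G) (hΓ : IsClosed (Γ : Set G)) : BorelSpace (G ⧸ Γ) := by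
  refine ⟨?_⟩
  rw [← Literature.MeasureTheory.Group.map_mk_borel_eq_borel Γ hΓ, ← ‹BorelSpace G›.measurable_eq]
  rfl

/-- **Invariant measures of finite volume on quotients by discrete subgroups.** Let `G` be a
locally compact, second countable Hausdorff group, `Γ ≤ G` a discrete subgroup on which the
modular function of `G` is trivial, `ν` a left Haar measure of `G`, and suppose some Borel set
`C ⊆ G` of finite measure `ν C < ∞` meets every coset `g Γ`. Then `G ⧸ Γ` carries a finite
`G`-invariant Borel measure which is positive on non-empty open sets and inner regular.
Construction (Raghunathan (1972), Ch. I, 1.4–1.9; Folland (1995), Thm. 2.49): `ν` is right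
`Γ`-invariant (`Δ|_Γ = 1`); restrict it to a Borel fundamental domain `𝓕` of `Γ`
(`Subgroup.exists_isFundamentalDomain_op_of_discrete`) and push it to `G ⧸ Γ`; the result is
`G`-invariant (Mathlib `QuotientMeasureEqMeasurePreimage.smulInvariantMeasure_quotient`), finite
since `ν 𝓕 ≤ ν C`, positive on opens since a `Γ`-invariant set meeting `𝓕` in a null set is null,
and inner regular as the image of the regular measure `ν|_𝓕`. (For `G = GL_n(𝔸_K)¹`,
`Γ = GL_n(K)` and `C` a Siegel set this is Borel–Harish-Chandra's construction, Borel (1963) §5.)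
[folklore] -/
theorem exists_smulInvariantMeasure_quotient_of_cover (Γ : Subgroup G) [DiscreteTopology Γ]
    (hmod : ∀ γ ∈ Γ, modularCharacter γ = 1) (ν : Measure G) [ν.IsHaarMeasure] {C : Set G}
    (hCcov : (QuotientGroup.mk : G → G ⧸ Γ) '' C = Set.univ) (hCfin : ν C < ∞) :
    ∃ μ : Measure (G ⧸ Γ), IsFiniteMeasure μ ∧ μ.IsOpenPosMeasure ∧ μ.InnerRegularCompactLTTop ∧
      SMulInvariantMeasure G (G ⧸ Γ) μ := by
  classical
  -- `Γ` is closed and countable; `G` is Polish; the quotient is Hausdorff, second countable, Borel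
  haveI hΓc : IsClosed (Γ : Set G) := Subgroup.isClosed_of_discrete
  haveI : Countable Γ := by
    haveI : SecondCountableTopology Γ := TopologicalSpace.Subtype.secondCountableTopology _
    exact countable_of_Lindelof_of_discrete
  haveI : Countable Γ.op := Countable.of_equiv _ (Subgroup.equivOp Γ)
  haveI : PolishSpace G :=
    Literature.Topology.Metrizable.polishSpace_of_locallyCompactSpace_of_secondCountableTopology G
  haveI : BorelSpace (G ⧸ Γ) := borelSpace_quotient Γ hΓc
  haveI : T2Space (G ⧸ Γ) := inferInstance
  haveI : SecondCountableTopology (G ⧸ Γ) := inferInstance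
  -- the left Haar measure `ν` is regular, and right invariant under `Γ`
  haveI : ν.Regular := inferInstance
  have hmod' : ∀ γ : Γ.op, modularCharacterFun ((γ : Gᵐᵒᵖ).unop) = 1 := fun γ =>
    hmod _ (Subgroup.mem_op.1 γ.2)
  haveI : SMulInvariantMeasure Γ.op G ν := by
    refine ⟨fun γ s hs => ?_⟩
    have hfun : (fun x : G => γ • x) = fun x => x * (γ : Gᵐᵒᵖ).unop := by
      funext x
      rw [Subgroup.smul_def, MulOpposite.smul_eq_mul_unop]
    rw [hfun, ← Measure.map_apply (measurable_mul_const _) hs,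
      map_right_mul_eq_modularCharacterFun_smul ν, hmod' γ, one_smul]
  -- a Borel fundamental domain and the quotient measure
  obtain ⟨𝓕, h𝓕m, h𝓕⟩ :=
    Literature.MeasureTheory.Group.Subgroup.exists_isFundamentalDomain_op_of_discrete Γ ν
  haveI : HasFundamentalDomain Γ.op G ν := ⟨⟨𝓕, h𝓕⟩⟩
  set μ : Measure (G ⧸ Γ) := (ν.restrict 𝓕).map (QuotientGroup.mk : G → G ⧸ Γ) with hμ
  haveI : QuotientMeasureEqMeasurePreimage ν μ :=
    h𝓕.quotientMeasureEqMeasurePreimage_quotientMeasure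
  have hinv : SMulInvariantMeasure G (G ⧸ Γ) μ :=
    MeasureTheory.QuotientMeasureEqMeasurePreimage.smulInvariantMeasure_quotient ν
  have hmeas : Measurable (QuotientGroup.mk : G → G ⧸ Γ) := QuotientGroup.continuous_mk.measurable
  have hμU : ∀ U : Set (G ⧸ Γ), MeasurableSet U →
      μ U = ν ((QuotientGroup.mk : G → G ⧸ Γ) ⁻¹' U ∩ 𝓕) := fun U hU => by
    rw [hμ, Measure.map_apply hmeas hU, Measure.restrict_apply (hmeas hU)]
  -- finiteness: `ν 𝓕 ≤ ν C`
  have hcovC : (⋃ g : Γ.op, g • C) = Set.univ := by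
    refine Set.eq_univ_of_forall fun x => ?_
    have hx : (QuotientGroup.mk x : G ⧸ Γ) ∈ (QuotientGroup.mk : G → G ⧸ Γ) '' C := by
      rw [hCcov]; exact Set.mem_univ _
    obtain ⟨c, hc, hcx⟩ := hx
    obtain ⟨γ, hγ⟩ : ∃ γ : Γ, x * γ = c := by
      have h := QuotientGroup.eq.1 hcx.symm
      exact ⟨⟨x⁻¹ * c, h⟩, by rw [mul_inv_cancel_left]⟩
    refine Set.mem_iUnion.2 ⟨⟨MulOpposite.op (γ : G)⁻¹, Subgroup.mem_op.2 (by
      simpa only [MulOpposite.unop_op] using Γ.inv_mem γ.2)⟩, ?_⟩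
    rw [Set.mem_smul_set_iff_inv_smul_mem, Subgroup.smul_def]
    change (MulOpposite.op (γ : G)⁻¹ : Gᵐᵒᵖ)⁻¹ • x ∈ C
    rw [← MulOpposite.op_inv, inv_inv, MulOpposite.smul_eq_mul_unop, MulOpposite.unop_op, hγ]
    exact hc
  have h𝓕le : ν 𝓕 ≤ ν C := by
    calc ν 𝓕 = ν (⋃ g : Γ.op, g • C ∩ 𝓕) := by
          rw [← Set.iUnion_inter, hcovC, Set.univ_inter]
      _ ≤ ∑' g : Γ.op, ν (g • C ∩ 𝓕) := measure_iUnion_le _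
      _ = ν C := (h𝓕.measure_eq_tsum C).symm
  have hfin : IsFiniteMeasure μ := by
    refine ⟨?_⟩
    rw [hμU _ MeasurableSet.univ, Set.preimage_univ, Set.univ_inter]
    exact h𝓕le.trans_lt hCfin
  -- positivity on open sets
  have hpos : μ.IsOpenPosMeasure := by
    refine ⟨fun U hUo hUne => ?_⟩
    intro hU0
    set V : Set G := (QuotientGroup.mk : G → G ⧸ Γ) ⁻¹' U with hV
    have hVo : IsOpen V := hUo.preimage QuotientGroup.continuous_mk
    have hVne : V.Nonempty := by
      obtain ⟨q, hq⟩ := hUne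
      obtain ⟨x, rfl⟩ := QuotientGroup.mk_surjective q
      exact ⟨x, hq⟩
    have hVinv : ∀ g : Γ.op, g • V = V := by
      intro g
      ext x
      rw [Set.mem_smul_set_iff_inv_smul_mem, Subgroup.smul_def, MulOpposite.smul_eq_mul_unop]
      simp only [hV, Set.mem_preimage]
      rw [QuotientGroup.mk_mul_of_mem]
      exact Subgroup.mem_op.1 (g⁻¹).2
    have hV0 : ν V = 0 := by
      refine h𝓕.measure_zero_of_invariant V hVinv ?_
      rw [← hμU U hUo.measurableSet]
      exact hU0
    exact (hVo.measure_pos ν hVne).ne' hV0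
  -- inner regularity: image of the regular measure `ν|_𝓕` under the continuous quotient map
  have hreg : μ.InnerRegularCompactLTTop := by
    rw [hμ]
    exact Measure.InnerRegularCompactLTTop.map_of_continuous QuotientGroup.continuous_mk
  exact ⟨μ, hfin, hpos, hreg, hinv⟩

/-- **Invariant probability measures on compact quotients by discrete subgroups.** Let `G` be a
locally compact, second countable Hausdorff group and `Γ ≤ G` a discrete subgroup on which the
modular function of `G` is trivial, with `G ⧸ Γ` compact. Then `G ⧸ Γ` carries a finite
`G`-invariant Borel measure which is positive on non-empty open sets. Construction (Raghunathan
(1972), Ch. I, 1.4–1.9; Folland (1995), Thm. 2.49): a left Haar measure `ν` of `G` is right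
`Γ`-invariant (`Δ|_Γ = 1`); restrict it to a Borel fundamental domain `𝓕` of `Γ`
(`Subgroup.exists_isFundamentalDomain_op_of_discrete`) and push it to `G ⧸ Γ`; the result is
`G`-invariant (Mathlib `QuotientMeasureEqMeasurePreimage.smulInvariantMeasure_quotient`), finite
since `ν 𝓕 ≤ ν C` for a compact `C` covering `G ⧸ Γ`, and positive on opens since a
`Γ`-invariant set meeting `𝓕` in a null set is null.
(`exists_smulInvariantMeasure_quotient_of_cover` with a compact covering set,
`exists_isCompact_image_coe_eq_univ`.) [folklore] -/
theorem exists_smulInvariantMeasure_quotient_of_compactSpace (Γ : Subgroup G) [DiscreteTopology Γ]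
    (hmod : ∀ γ ∈ Γ, modularCharacter γ = 1) [CompactSpace (G ⧸ Γ)] :
    ∃ μ : Measure (G ⧸ Γ), IsFiniteMeasure μ ∧ μ.IsOpenPosMeasure ∧
      SMulInvariantMeasure G (G ⧸ Γ) μ := by
  obtain ⟨C, hC, hCcov⟩ := exists_isCompact_image_coe_eq_univ Γ
  obtain ⟨μ, hfin, hpos, -, hinv⟩ :=
    exists_smulInvariantMeasure_quotient_of_cover Γ hmod haar hCcov hC.measure_lt_top
  exact ⟨μ, hfin, hpos, hinv⟩

end Quotient

/-! ### Automorphic measures on compact automorphic quotients -/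

namespace AdelicGroupData

variable {K : Type} [Field K] [NumberField K]

/-- **`A_G · G(K)` through a central retraction.** If `θ : G(𝔸_K) →* G(𝔸_K)` takes values in
`A_G`, is the identity on `A_G` and is trivial on `G(K)`, then `g ∈ A_G · G(K)` iff
`θ(g)⁻¹ g ∈ G(K)` (if `g = a γ` then `θ(g) = a`; conversely `g = θ(g) · θ(g)⁻¹ g`; `A_G` is
central, so `A_G ⊔ G(K) = A_G · G(K)` as sets). Compare `quotientSubgroup_gl_eq_preimage`.
[folklore] -/
theorem mem_quotientSubgroup_iff_of_centralRetraction (𝒢 : AdelicGroupData.{u} K)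
    (θ : 𝒢.Adelic →* 𝒢.Adelic) (hθA : ∀ g, θ g ∈ 𝒢.center') (hθa : ∀ a ∈ 𝒢.center', θ a = a)
    (hθγ : ∀ γ ∈ 𝒢.arithmeticSubgroup, θ γ = 1) (g : 𝒢.Adelic) :
    g ∈ 𝒢.quotientSubgroup ↔ (θ g)⁻¹ * g ∈ 𝒢.arithmeticSubgroup := by
  haveI : 𝒢.center'.Normal :=
    ⟨fun a ha x => by
      rw [Subgroup.mem_center_iff.1 (𝒢.center'_le ha) x, mul_inv_cancel_right]; exact ha⟩
  constructor
  · intro hg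
    have hg' : g ∈ ((𝒢.center' ⊔ 𝒢.arithmeticSubgroup : Subgroup 𝒢.Adelic) : Set 𝒢.Adelic) := hg
    rw [Subgroup.normal_mul] at hg'
    obtain ⟨a, ha, γ, hγ, rfl⟩ := hg'
    have : θ (a * γ) = a := by rw [map_mul, hθa a ha, hθγ γ hγ, mul_one]
    rwa [this, inv_mul_cancel_left]
  · intro hg
    have : g = θ g * ((θ g)⁻¹ * g) := by rw [mul_inv_cancel_left]
    rw [this]
    exact Subgroup.mul_mem_sup (hθA g) hg

/-- **`A_G · G(K)` is closed** when `G(K)` is discrete, `G(𝔸_K)` is Hausdorff and a continuous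
central retraction `θ` exists: it is the preimage of the closed (discrete) subgroup `G(K)` under
the continuous map `g ↦ θ(g)⁻¹ g` (`mem_quotientSubgroup_iff_of_centralRetraction`; cf.
`isClosed_quotientSubgroup_gl_holds`, Borel (1963) §5). [folklore] -/
theorem isClosed_quotientSubgroup_of_centralRetraction (𝒢 : AdelicGroupData.{u} K)
    [T2Space 𝒢.Adelic] (hdisc : 𝒢.IsDiscreteRational) (θ : 𝒢.Adelic →* 𝒢.Adelic)
    (hθc : Continuous θ) (hθA : ∀ g, θ g ∈ 𝒢.center') (hθa : ∀ a ∈ 𝒢.center', θ a = a)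
    (hθγ : ∀ γ ∈ 𝒢.arithmeticSubgroup, θ γ = 1) :
    IsClosed (𝒢.quotientSubgroup : Set 𝒢.Adelic) := by
  haveI : DiscreteTopology 𝒢.arithmeticSubgroup := hdisc
  have hΓc : IsClosed (𝒢.arithmeticSubgroup : Set 𝒢.Adelic) := Subgroup.isClosed_of_discrete
  have : (𝒢.quotientSubgroup : Set 𝒢.Adelic) =
      (fun g => (θ g)⁻¹ * g) ⁻¹' (𝒢.arithmeticSubgroup : Set 𝒢.Adelic) :=
    Set.ext fun g => mem_quotientSubgroup_iff_of_centralRetraction 𝒢 θ hθA hθa hθγ g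
  rw [this]
  exact hΓc.preimage (hθc.inv.mul continuous_id)

/-- **Splitting off `A_G`: `G(𝔸_K) ⧸ (A_G · G(K)) ≃ₜ G(𝔸_K)¹ ⧸ G(K)`.** For a continuous central
retraction `θ` (values in `A_G`, identity on `A_G`, trivial on `G(K)`), let `G(𝔸_K)¹ = ker θ`
(which contains `G(K)`) and `r(g) = θ(g)⁻¹ g`, a continuous homomorphism `G(𝔸_K) →* G(𝔸_K)¹`
(since `θ` is central) restricting to the identity on `G(𝔸_K)¹`. The inclusion
`G(𝔸_K)¹ ↪ G(𝔸_K)` and `r` induce inverse homeomorphisms between `G(𝔸_K)¹ ⧸ G(K)` and the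
automorphic quotient `G(𝔸_K) ⧸ (A_G · G(K))` (both continuous by the universal property of the
quotient maps), intertwining the action of `g ∈ G(𝔸_K)` on the automorphic quotient with that of
`r(g)` on `G(𝔸_K)¹ ⧸ G(K)`. (Weil's splitting `k_𝔸ˣ = k_𝔸¹ × M`, BNT IV §4; Borel (1963) §5:
`G_A = G_A¹ × A`.) [folklore] -/
theorem exists_retraction_homeomorph (𝒢 : AdelicGroupData.{u} K) (θ : 𝒢.Adelic →* 𝒢.Adelic)
    (hθc : Continuous θ) (hθA : ∀ g, θ g ∈ 𝒢.center') (hθa : ∀ a ∈ 𝒢.center', θ a = a)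
    (hθγ : ∀ γ ∈ 𝒢.arithmeticSubgroup, θ γ = 1) :
    ∃ (r : 𝒢.Adelic →* θ.ker)
      (e : (θ.ker ⧸ 𝒢.arithmeticSubgroup.subgroupOf θ.ker) ≃ₜ 𝒢.automorphicQuotient),
      Continuous r ∧ (∀ g, ((r g : θ.ker) : 𝒢.Adelic) = (θ g)⁻¹ * g) ∧ (∀ x : θ.ker, r x = x) ∧
      (∀ x : θ.ker, e (QuotientGroup.mk x : θ.ker ⧸ 𝒢.arithmeticSubgroup.subgroupOf θ.ker) =
        𝒢.toAutomorphicQuotient (x : 𝒢.Adelic)) ∧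
      ∀ (g : 𝒢.Adelic) (q : θ.ker ⧸ 𝒢.arithmeticSubgroup.subgroupOf θ.ker),
        g • e q = e (r g • q) := by
  classical
  set G₁ : Subgroup 𝒢.Adelic := θ.ker with hG₁
  -- algebra of the retraction
  have hcen : ∀ g, θ g ∈ Subgroup.center 𝒢.Adelic := fun g => 𝒢.center'_le (hθA g)
  have hcomm : ∀ g x : 𝒢.Adelic, θ g * x = x * θ g := fun g x =>
    (Subgroup.mem_center_iff.1 (hcen g) x).symm
  have hci : ∀ g y : 𝒢.Adelic, (θ g)⁻¹ * y = y * (θ g)⁻¹ := fun g y =>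
    (Subgroup.mem_center_iff.1 (inv_mem (hcen g)) y).symm
  have hθθ : ∀ g, θ (θ g) = θ g := fun g => hθa _ (hθA g)
  have hr : ∀ g, (θ g)⁻¹ * g ∈ G₁ := fun g => by
    rw [hG₁, MonoidHom.mem_ker, map_mul, map_inv, hθθ, inv_mul_cancel]
  -- the retraction `r(g) = θ(g)⁻¹ g`, a homomorphism since `θ` is central
  let r : 𝒢.Adelic →* G₁ := MonoidHom.mk' (fun g => ⟨(θ g)⁻¹ * g, hr g⟩) fun x y =>
    Subtype.ext (by
      change (θ (x * y))⁻¹ * (x * y) = (θ x)⁻¹ * x * ((θ y)⁻¹ * y)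
      rw [map_mul, mul_inv_rev, hci y y, ← mul_assoc ((θ x)⁻¹ * x) y (θ y)⁻¹,
        mul_assoc (θ x)⁻¹ x y, mul_assoc (θ y)⁻¹ (θ x)⁻¹ (x * y),
        hci y ((θ x)⁻¹ * (x * y))])
  have hrcoe : ∀ g, ((r g : G₁) : 𝒢.Adelic) = (θ g)⁻¹ * g := fun g => rfl
  have hrG₁ : ∀ x : G₁, r x = x := fun x => Subtype.ext (by
    rw [hrcoe, show θ x = 1 from (MonoidHom.mem_ker).1 x.2, inv_one, one_mul])
  have hH : ∀ g, g ∈ 𝒢.quotientSubgroup ↔ (θ g)⁻¹ * g ∈ 𝒢.arithmeticSubgroup :=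
    mem_quotientSubgroup_iff_of_centralRetraction 𝒢 θ hθA hθa hθγ
  -- the subgroup `Γ₁ = G(K)` of `G(𝔸_K)¹`
  set Γ₁ : Subgroup G₁ := 𝒢.arithmeticSubgroup.subgroupOf G₁ with hΓ₁
  have hmemΓ₁ : ∀ x : G₁, x ∈ Γ₁ ↔ (x : 𝒢.Adelic) ∈ 𝒢.arithmeticSubgroup := fun x =>
    Subgroup.mem_subgroupOf
  -- the two maps
  let f : G₁ ⧸ Γ₁ → 𝒢.automorphicQuotient :=
    Quotient.map' (fun x : G₁ => (x : 𝒢.Adelic)) fun a b hab => by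
      rw [QuotientGroup.leftRel_apply] at hab ⊢
      exact 𝒢.arithmeticSubgroup_le_quotientSubgroup ((hmemΓ₁ _).1 hab)
  let b : 𝒢.automorphicQuotient → G₁ ⧸ Γ₁ :=
    Quotient.map' r fun a c hac => by
      rw [QuotientGroup.leftRel_apply] at hac ⊢
      rw [hmemΓ₁, ← map_inv, ← map_mul, hrcoe]
      exact (hH _).1 hac
  have hfb : ∀ q, f (b q) = q := by
    intro q
    induction q using Quotient.inductionOn' with
    | h g =>
      change (QuotientGroup.mk ((θ g)⁻¹ * g) : 𝒢.Adelic ⧸ 𝒢.quotientSubgroup) = QuotientGroup.mk g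
      rw [QuotientGroup.eq, mul_inv_rev, inv_inv, mul_assoc, hcomm g g, inv_mul_cancel_left]
      exact 𝒢.center'_le_quotientSubgroup (hθA g)
  have hbf : ∀ q, b (f q) = q := by
    intro q
    induction q using Quotient.inductionOn' with
    | h x =>
      change (QuotientGroup.mk (r x) : G₁ ⧸ Γ₁) = QuotientGroup.mk x
      rw [hrG₁ x]
  have hfc : Continuous f := continuous_subtype_val.quotient_map' _
  have hrc : Continuous (r : 𝒢.Adelic → G₁) := (hθc.inv.mul continuous_id).subtype_mk _
  have hbc : Continuous b := hrc.quotient_map' _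
  let e : G₁ ⧸ Γ₁ ≃ₜ 𝒢.automorphicQuotient :=
    { toFun := f
      invFun := b
      left_inv := hbf
      right_inv := hfb
      continuous_toFun := hfc
      continuous_invFun := hbc }
  refine ⟨r, e, hrc, hrcoe, hrG₁, fun x => rfl, fun g q => ?_⟩
  induction q using Quotient.inductionOn' with
  | h x =>
    change (QuotientGroup.mk (g * x) : 𝒢.Adelic ⧸ 𝒢.quotientSubgroup) =
      QuotientGroup.mk ((θ g)⁻¹ * g * x)
    rw [QuotientGroup.eq, mul_assoc (θ g)⁻¹ g (x : 𝒢.Adelic), hci g (g * x),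
      inv_mul_cancel_left]
    exact 𝒢.center'_le_quotientSubgroup (inv_mem (hθA g))

/-- **Existence of the automorphic measure from a covering set of finite volume** (the shape of
Borel–Harish-Chandra's theorem, Borel (1963) §5, Thm. 5.8: a Siegel set of finite Haar measure
meeting every coset). Let `𝒢` be an adelic group datum with `G(𝔸_K)` locally compact, second
countable and Hausdorff and `G(K)` discrete; `θ` a continuous central retraction (values in `A_G`,
identity on `A_G`, trivial on `G(K)`) with `G(𝔸_K)¹ = ker θ` locally compact (hypothesis `hlc`,
explicit so that it can be supplied for the syntactic form of `𝒢.Adelic` at hand) and the modular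
function of `G(𝔸_K)¹` trivial on `G(K)`; and `C ⊆ G(𝔸_K)¹` a set meeting every coset of
`A_G · G(K)` whose Haar measure in `G(𝔸_K)¹` is finite (for some Borel structure and some Haar
measure of `G(𝔸_K)¹`, hypothesis `hfin`). Then the automorphic quotient carries an automorphic
measure (`IsAutomorphicMeasure`: finite, positive on non-empty open sets, inner regular,
`G(𝔸_K)`-invariant): transport the measure of `exists_smulInvariantMeasure_quotient_of_cover` for
the discrete subgroup `G(K)` of `G(𝔸_K)¹` along the equivariant homeomorphism
`exists_retraction_homeomorph`. [cite: Borel1963, §5] -/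
theorem exists_isAutomorphicMeasure_of_cover (𝒢 : AdelicGroupData.{u} K)
    [LocallyCompactSpace 𝒢.Adelic] [SecondCountableTopology 𝒢.Adelic] [T2Space 𝒢.Adelic]
    (hdisc : 𝒢.IsDiscreteRational) (θ : 𝒢.Adelic →* 𝒢.Adelic) (hθc : Continuous θ)
    (hθA : ∀ g, θ g ∈ 𝒢.center') (hθa : ∀ a ∈ 𝒢.center', θ a = a)
    (hθγ : ∀ γ ∈ 𝒢.arithmeticSubgroup, θ γ = 1) (hlc : LocallyCompactSpace θ.ker)
    (hmod : ∀ γ (hγ : γ ∈ 𝒢.arithmeticSubgroup),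
      modularCharacter (⟨γ, (MonoidHom.mem_ker).2 (hθγ γ hγ)⟩ : θ.ker) = 1)
    {C : Set 𝒢.Adelic} (hC : C ⊆ θ.ker) (hcov : 𝒢.toAutomorphicQuotient '' C = Set.univ)
    (hfin : ∃ (_ : MeasurableSpace θ.ker) (_ : BorelSpace θ.ker) (ν : Measure θ.ker)
      (_ : ν.IsHaarMeasure), ν (Subtype.val ⁻¹' C) < ∞) :
    ∃ μ : Measure 𝒢.automorphicQuotient, 𝒢.IsAutomorphicMeasure μ := by
  classical
  obtain ⟨r, e, -, -, -, hemk, hesmul⟩ := exists_retraction_homeomorph 𝒢 θ hθc hθA hθa hθγ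
  have hmemΓ₁ : ∀ x : θ.ker, x ∈ 𝒢.arithmeticSubgroup.subgroupOf θ.ker ↔
      (x : 𝒢.Adelic) ∈ 𝒢.arithmeticSubgroup := fun x => Subgroup.mem_subgroupOf
  -- topology: `A_G · G(K)` and `G(𝔸_K)¹` are closed, `G(K)` is discrete in `G(𝔸_K)¹`
  haveI : DiscreteTopology 𝒢.arithmeticSubgroup := hdisc
  haveI hHc : IsClosed (𝒢.quotientSubgroup : Set 𝒢.Adelic) :=
    isClosed_quotientSubgroup_of_centralRetraction 𝒢 hdisc θ hθc hθA hθa hθγ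
  haveI : SecondCountableTopology θ.ker := TopologicalSpace.Subtype.secondCountableTopology _
  haveI : T2Space 𝒢.automorphicQuotient :=
    inferInstanceAs (T2Space (𝒢.Adelic ⧸ 𝒢.quotientSubgroup))
  haveI : SecondCountableTopology 𝒢.automorphicQuotient :=
    inferInstanceAs (SecondCountableTopology (𝒢.Adelic ⧸ 𝒢.quotientSubgroup))
  haveI : DiscreteTopology (𝒢.arithmeticSubgroup.subgroupOf θ.ker) := by
    refine DiscreteTopology.of_continuous_injective
      (f := fun x : 𝒢.arithmeticSubgroup.subgroupOf θ.ker =>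
        (⟨(x : θ.ker), (hmemΓ₁ x).1 x.2⟩ : 𝒢.arithmeticSubgroup)) ?_ ?_
    · exact (continuous_subtype_val.comp continuous_subtype_val).subtype_mk _
    · intro a b hab
      have h : ((a : θ.ker) : 𝒢.Adelic) = ((b : θ.ker) : 𝒢.Adelic) :=
        congrArg (fun y : 𝒢.arithmeticSubgroup => (y : 𝒢.Adelic)) hab
      exact Subtype.ext (Subtype.ext h)
  have hΓ₁c : IsClosed (𝒢.arithmeticSubgroup.subgroupOf θ.ker : Set θ.ker) :=
    Subgroup.isClosed_of_discrete
  have hmod₁ : ∀ γ ∈ 𝒢.arithmeticSubgroup.subgroupOf θ.ker, modularCharacter γ = 1 := by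
    intro γ hγ
    have h := hmod (γ : 𝒢.Adelic) ((hmemΓ₁ γ).1 hγ)
    have he : (⟨(γ : 𝒢.Adelic), (MonoidHom.mem_ker).2 (hθγ _ ((hmemΓ₁ γ).1 hγ))⟩ : θ.ker) = γ :=
      Subtype.ext rfl
    rwa [he] at h
  -- the Borel structure and the Haar measure of `G(𝔸_K)¹` in which `C` has finite volume
  obtain ⟨m, hb, ν, hν, hCfin⟩ := hfin
  letI : MeasurableSpace θ.ker := m
  haveI : BorelSpace θ.ker := hb
  haveI : ν.IsHaarMeasure := hν
  haveI : BorelSpace (θ.ker ⧸ 𝒢.arithmeticSubgroup.subgroupOf θ.ker) :=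
    borelSpace_quotient (𝒢.arithmeticSubgroup.subgroupOf θ.ker) hΓ₁c
  -- `C` covers `G(𝔸_K)¹ ⧸ G(K)`
  have hcov₁ : (QuotientGroup.mk : θ.ker → θ.ker ⧸ 𝒢.arithmeticSubgroup.subgroupOf θ.ker) ''
      (Subtype.val ⁻¹' C) = Set.univ := by
    refine Set.eq_univ_of_forall fun q => ?_
    have hq : e q ∈ 𝒢.toAutomorphicQuotient '' C := by rw [hcov]; exact Set.mem_univ _
    obtain ⟨c, hc, hcq⟩ := hq
    refine ⟨⟨c, hC hc⟩, hc, e.injective ?_⟩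
    rw [hemk]
    exact hcq
  obtain ⟨μ₁, hfin₁, hpos₁, hreg₁, hinv₁⟩ :=
    exists_smulInvariantMeasure_quotient_of_cover (𝒢.arithmeticSubgroup.subgroupOf θ.ker) hmod₁ ν
      hcov₁ hCfin
  -- transport to the automorphic quotient
  have hem : Measurable e := e.continuous.measurable
  set μ : Measure 𝒢.automorphicQuotient := μ₁.map e with hμ
  have hμs : ∀ s : Set 𝒢.automorphicQuotient, MeasurableSet s → μ s = μ₁ (e ⁻¹' s) :=
    fun s hs => by rw [hμ, Measure.map_apply hem hs]
  haveI : IsFiniteMeasure μ := inferInstance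
  haveI : μ.IsOpenPosMeasure := e.continuous.isOpenPosMeasure_map e.surjective
  haveI : μ.InnerRegularCompactLTTop :=
    Measure.InnerRegularCompactLTTop.map_of_continuous e.continuous
  haveI : SMulInvariantMeasure 𝒢.Adelic 𝒢.automorphicQuotient μ := by
    refine ⟨fun g s hs => ?_⟩
    have hgs : MeasurableSet ((fun q : 𝒢.automorphicQuotient => g • q) ⁻¹' s) :=
      measurable_const_smul g hs
    rw [hμs s hs, hμs _ hgs]
    have hset : e ⁻¹' ((fun q : 𝒢.automorphicQuotient => g • q) ⁻¹' s) =
        (fun q : θ.ker ⧸ 𝒢.arithmeticSubgroup.subgroupOf θ.ker => r g • q) ⁻¹' (e ⁻¹' s) := by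
      ext q
      simp only [Set.mem_preimage]
      rw [hesmul]
    rw [hset]
    exact hinv₁.measure_preimage_smul _ (hem hs)
  exact ⟨μ, {}⟩

/-- **Existence of the automorphic measure on a compact automorphic quotient.** Let `𝒢` be an
adelic group datum with `G(𝔸_K)` locally compact, second countable and Hausdorff and `G(K)`
discrete, and let `θ : G(𝔸_K) →* G(𝔸_K)` be a continuous homomorphism with values in `A_G`,
the identity on `A_G` and trivial on `G(K)` (a *central retraction*, as
`exists_centralRetraction_gl`), such that the modular function of `G(𝔸_K)¹ := ker θ` is trivial
on `G(K)` (`ker θ` is closed, hence locally compact: hypothesis `hlc`, explicit so that it can be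
supplied for the syntactic form of `𝒢.Adelic` at hand). If the automorphic quotient
`G(𝔸_K) ⧸ (A_G · G(K))` is compact, it carries an automorphic measure (`IsAutomorphicMeasure`:
finite, positive on non-empty open sets, inner regular, `G(𝔸_K)`-invariant). Proof:
`G(𝔸_K)¹ ⧸ G(K) ≃ₜ G(𝔸_K) ⧸ (A_G · G(K))` (`exists_retraction_homeomorph`) is compact, so a
compact subset of `G(𝔸_K)¹` — of finite Haar measure — meets every coset, and
`exists_isAutomorphicMeasure_of_cover` applies. (Borel (1963), §5: finite invariant measure on
`G_A / G_k A` from a fundamental set; Raghunathan (1972), Ch. I, 1.4–1.9.) [cite: Borel1963, §5] -/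
theorem exists_isAutomorphicMeasure_of_compactSpace (𝒢 : AdelicGroupData.{u} K)
    [LocallyCompactSpace 𝒢.Adelic] [SecondCountableTopology 𝒢.Adelic] [T2Space 𝒢.Adelic]
    (hdisc : 𝒢.IsDiscreteRational) (θ : 𝒢.Adelic →* 𝒢.Adelic) (hθc : Continuous θ)
    (hθA : ∀ g, θ g ∈ 𝒢.center') (hθa : ∀ a ∈ 𝒢.center', θ a = a)
    (hθγ : ∀ γ ∈ 𝒢.arithmeticSubgroup, θ γ = 1) (hlc : LocallyCompactSpace θ.ker)
    (hmod : ∀ γ (hγ : γ ∈ 𝒢.arithmeticSubgroup),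
      modularCharacter (⟨γ, (MonoidHom.mem_ker).2 (hθγ γ hγ)⟩ : θ.ker) = 1)
    [CompactSpace 𝒢.automorphicQuotient] :
    ∃ μ : Measure 𝒢.automorphicQuotient, 𝒢.IsAutomorphicMeasure μ := by
  classical
  obtain ⟨r, e, -, -, -, hemk, -⟩ := exists_retraction_homeomorph 𝒢 θ hθc hθA hθa hθγ
  haveI : CompactSpace (θ.ker ⧸ 𝒢.arithmeticSubgroup.subgroupOf θ.ker) := e.symm.compactSpace
  obtain ⟨C₁, hC₁, hC₁cov⟩ :=
    exists_isCompact_image_coe_eq_univ (𝒢.arithmeticSubgroup.subgroupOf θ.ker)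
  refine exists_isAutomorphicMeasure_of_cover 𝒢 hdisc θ hθc hθA hθa hθγ hlc hmod
    (C := Subtype.val '' C₁) (fun _ ⟨x, _, hx⟩ => hx ▸ x.2) ?_ ?_
  · refine Set.eq_univ_of_forall fun q => ?_
    have hq : e.symm q ∈ (QuotientGroup.mk :
        θ.ker → θ.ker ⧸ 𝒢.arithmeticSubgroup.subgroupOf θ.ker) '' C₁ := by
      rw [hC₁cov]; exact Set.mem_univ _
    obtain ⟨x, hx, hxq⟩ := hq
    refine ⟨x, ⟨x, hx, rfl⟩, ?_⟩
    rw [← hemk, hxq, e.apply_symm_apply]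
  · letI : MeasurableSpace θ.ker := borel _
    haveI : BorelSpace θ.ker := ⟨rfl⟩
    refine ⟨‹MeasurableSpace θ.ker›, ‹BorelSpace θ.ker›, haar, inferInstance, ?_⟩
    rw [Subtype.val_injective.preimage_image]
    exact hC₁.measure_lt_top

end AdelicGroupData

end Literature.NumberTheory.Automorphic
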